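import Literature.AlgebraicGeometry.HodgeTheory.HardLefschetzHodgeRiemannHolds
import Literature.AlgebraicGeometry.HodgeTheory.CanonicalTrace
import Literature.AlgebraicGeometry.HodgeTheory.HodgeClassOfMorphismProofs
import Literature.AlgebraicGeometry.HodgeTheory.VanishingCohomologyNontrivialProofs
import Literature.AlgebraicGeometry.HodgeTheory.HodgeSectionRestrictionPairing
import Mathlib.LinearAlgebra.Matrix.NonsingularInverse
import HarnessLib

/-!
# Crux `HodgeProjectorAlgebraic` (stmt-HodgeConjecture-18705), line `birth` — stub 2 `stub_gramKunnethClass`: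
# the orthogonal Hodge projector is the action of its Gram–Künneth class

Route `HodgeConjecture/HodgeProjectorDivisorSupport`, crux W2; registered skeleton `Cruxes/HodgeProjectorAlgebraic/Lines/birth.lean`.
This file closes the registered stub

* **`stub_gramKunnethClass`** (signature VERBATIM; theorem-grade, Voisin I Lemma 11.41 made explicit): for `X` smooth
  projective of dimension `2n ≥ 2` and ANY `ℂ`-linear `P` on `H^{2n}(X(ℂ); ℂ)` that is the identity on the rational
  `(n,n)`-classes and zero on their cup-orthogonal, there is a RATIONAL class `π₀ ∈ H^{4n}((X ⊗ X)(ℂ); ℂ)` of Hodge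
  type `(2n,2n)`, in the `ℂ`-span of the exterior products `pr₁^* a ∪ pr₂^* b` of rational `(n,n)`-classes, whose
  correspondence action `corrAction complexOrientationFamily` is `t • P`, `t ≠ 0`.

Ingredients: `exists_gramProjector` — a `ℂ`-basis `s₁, …, s_m` of `V = ℂ · Hdgⁿ(X)` made of rational `(n,n)`-classes,
the inverse `N = G⁻¹ ∈ GL_m(ℚ)` of the rational Gram matrix `G = (∫_X sᵢ ∪ sⱼ)` (invertible by the NON-DEGENERACY of the
cup pairing on Hodge classes, the tree's `hardLefschetz_hodgeRiemann_holds`), and the Gram projector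
`P₀ x = Σ_{k,j} N_{jk} (∫_X x ∪ sⱼ) s_k` with `P₀ sᵢ = sᵢ` and `∫ (P₀ x) ∪ sᵢ = ∫ x ∪ sᵢ`; `gramProjector_unique` — every `P`
as in the stub equals `P₀` (`x = P₀ x + (x - P₀ x)`, the second summand cup-orthogonal to `Hdgⁿ`); and the projection
formula `corrAction_sum_cross_apply` (Voisin I (11.11)) for `π₀ = Σ_{k,j} N_{jk} pr₁^* s_k ∪ pr₂^* sⱼ`:
`π₀_* u = λ Σ_k ⟨u, Σ_j N_{jk} sⱼ⟩ s_k = (λ ε₀) P₀ u`. Rationality: `IsRationalClass.pullback/.cup`; Hodge type: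
`isOfHodgeType_cupProduct_map_map_of_multiplicative_deRham` (de Rham's theorem `exists_deRhamIsoFamily_holds`).

No definition, no named fact, no sorry. References: [VoisinHodgeI2002] §11.3.3 Thm. 11.38, Lemma 11.41 with (11.11),
§7.1.2; [BrosnanFangNiePearlstein2009] §6 (6.1); [HatcherAT2002] §3.3 Prop. 3.38; [Kleiman1968] §2.
-/

noncomputable section

-- every declaration of this problem lives in `Summit.HodgeConjecture.HodgeConjecture.…` (summit = sub-problem)
set_option linter.dupNamespace false

open CategoryTheory AlgebraicGeometry MonoidalCategory CartesianMonoidalCategory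
open Literature.AlgebraicGeometry.Motives Literature.AlgebraicGeometry.HodgeTheory
open Literature.AlgebraicTopology.SingularHomology

namespace Summit.HodgeConjecture.HodgeConjecture.Theorems.HodgeProjectorAlgebraic

variable {n : ℕ} {X : SchemeOver ℂ}

/-! ## The Gram projector package -/

/-- **The Gram projector of the rational `(n,n)`-classes.** For `X` smooth projective of dimension `2n` there are
rational `(n,n)`-classes `s₁, …, s_m` spanning (over `ℂ`) all rational `(n,n)`-classes and a rational matrix `N`
(the inverse of the Gram matrix `(∫_X sᵢ ∪ sⱼ)`, invertible by the non-degeneracy of the cup pairing on Hodge classes,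
BFNP (6.1) / Hodge–Riemann) such that the operator `P₀ x = Σ_{k,j} N_{jk} (∫_X x ∪ sⱼ) s_k` fixes each `sᵢ` and
satisfies `∫_X (P₀ x) ∪ sᵢ = ∫_X x ∪ sᵢ`. [cite: BrosnanFangNiePearlstein2009, §6 display (6.1)]
[cite: VoisinHodgeI2002, §7.1.2 and Thm. 6.32] [cite: Kleiman1968, §2] -/
theorem exists_gramProjector (hX : IsSmoothProjective (2 * n) X) :
    ∃ (m : ℕ) (s : Fin m → complexBetti X (2 * n)) (N : Matrix (Fin m) (Fin m) ℚ),
      (∀ i, IsRationalClass (s i)) ∧ (∀ i, IsOfHodgeType (2 * n) X (2 * n) n n (s i)) ∧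
      (∀ c : complexBetti X (2 * n), IsRationalClass c → IsOfHodgeType (2 * n) X (2 * n) n n c →
        c ∈ Submodule.span ℂ (Set.range s)) ∧
      (∀ i, ∑ k, ∑ j, (((N j k : ℚ) : ℂ) *
          traceC hX (cupProduct (two_mul (2 * n)).symm (s i) (s j))) • s k = s i) ∧
      (∀ (x : complexBetti X (2 * n)) (i : Fin m),
        traceC hX (cupProduct (two_mul (2 * n)).symm
            (∑ k, ∑ j, (((N j k : ℚ) : ℂ) * traceC hX (cupProduct (two_mul (2 * n)).symm x (s j))) • s k)
            (s i)) =
          traceC hX (cupProduct (two_mul (2 * n)).symm x (s i))) := by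
  classical
  obtain ⟨A⟩ := nonempty_hodgeModel_holds (n := 2 * n) (X := X) hX
  haveI : Module.Finite ℂ (complexBetti X (2 * n)) := finite_complexBetti hX (2 * n)
  have h4 : 2 * n + 2 * n = 2 * (2 * n) := (two_mul (2 * n)).symm
  -- the rational `(n,n)`-classes and a `ℂ`-basis of their span taken among them, indexed by `Fin m`
  set S : Set (complexBetti X (2 * n)) :=
    {c | IsRationalClass c ∧ IsOfHodgeType (2 * n) X (2 * n) n n c} with hS
  obtain ⟨b, hbS, hbspan, hbli⟩ := exists_linearIndependent ℂ S
  have hbfin : b.Finite := hbli.setFinite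
  haveI : Fintype b := hbfin.fintype
  obtain ⟨m, ⟨e⟩⟩ : ∃ m, Nonempty (b ≃ Fin m) := ⟨Fintype.card b, ⟨Fintype.equivFin b⟩⟩
  let s : Fin m → complexBetti X (2 * n) := fun i ↦ (e.symm i : complexBetti X (2 * n))
  have hsli : LinearIndependent ℂ s := hbli.comp e.symm e.symm.injective
  have hsQ : ∀ i, IsRationalClass (s i) := fun i ↦ (hbS (e.symm i).2).1
  have hsT : ∀ i, IsOfHodgeType (2 * n) X (2 * n) n n (s i) := fun i ↦ (hbS (e.symm i).2).2
  have hrange : Set.range s = b := by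
    ext x
    constructor
    · rintro ⟨i, rfl⟩
      exact (e.symm i).2
    · intro hx
      exact ⟨e ⟨x, hx⟩, by simp [s]⟩
  have hmemS : ∀ a ∈ S, a ∈ Submodule.span ℂ (Set.range s) := fun a ha ↦ by
    rw [hrange, hbspan]
    exact Submodule.subset_span ha
  -- the rational Gram matrix `G = (∫ sᵢ ∪ sⱼ)`
  have hrat : ∀ i j, ∃ a : singularCohomology ℚ ℚ (ComplexPoints X) (2 * (2 * n)),
      singularCohomology.ringChange (algebraMap ℚ ℂ) (ComplexPoints X) (2 * (2 * n)) a =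
        cupProduct h4 (s i) (s j) :=
    fun i j ↦ ((hsQ i).cup h4 (hsQ j)).exists_ringChange_eq
  choose r hr using hrat
  let G : Matrix (Fin m) (Fin m) ℚ := Matrix.of fun i j ↦ trace hX (r i j)
  have hG : ∀ i j, ((G i j : ℚ) : ℂ) = traceC hX (cupProduct h4 (s i) (s j)) := by
    intro i j
    simp only [G, Matrix.of_apply]
    rw [← hr, traceC_ringChange, eq_ratCast]
  -- `G` is injective on rational row vectors: non-degeneracy of the cup pairing on Hodge classes
  have hker : ∀ q : Fin m → ℚ, Matrix.vecMul q G = 0 → q = 0 := by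
    intro q hq
    set c : complexBetti X (2 * n) := ∑ i, ((q i : ℚ) : ℂ) • s i with hc
    have hcQ : IsRationalClass c := isRationalClass_sum _ _ fun i _ ↦ (hsQ i).smul (q i)
    have hcT : IsOfHodgeType (2 * n) X (2 * n) n n c :=
      IsOfHodgeType.sum hX A _ _ fun i _ ↦ (hsT i).smul _
    have hcs : ∀ j, cupProduct h4 c (s j) = 0 := by
      intro j
      apply eq_zero_of_traceC_eq_zero hX
      have hqj : (((Matrix.vecMul q G) j : ℚ) : ℂ) = 0 := by rw [hq, Pi.zero_apply, Rat.cast_zero]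
      rw [Matrix.vecMul, dotProduct, Rat.cast_sum] at hqj
      simp only [Rat.cast_mul, hG] at hqj
      rw [hc, map_sum, LinearMap.sum_apply, map_sum, ← hqj]
      refine Finset.sum_congr rfl fun i _ ↦ ?_
      rw [map_smul, LinearMap.smul_apply, map_smul, smul_eq_mul]
    have hca : ∀ a ∈ S, cupProduct h4 c a = 0 := by
      intro a ha
      refine Submodule.span_induction (p := fun a _ ↦ cupProduct h4 c a = 0) ?_ ?_ ?_ ?_ (hmemS a ha)
      · rintro _ ⟨j, rfl⟩
        exact hcs j
      · exact map_zero _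
      · intro x y _ _ hx hy
        rw [map_add, hx, hy, add_zero]
      · intro t x _ hx
        rw [map_smul, hx, smul_zero]
    have hc0 : c = 0 := by
      by_contra hne
      obtain ⟨a, haQ, haT, hne'⟩ :=
        hardLefschetz_hodgeRiemann_holds.hodgeClasses_cupPairing_nondegenerate hX (2 * (2 * n))
          (by omega : n + n = 2 * n) h4 c hcQ hcT hne
      exact hne' (hca a ⟨haQ, haT⟩)
    have hq0 := Fintype.linearIndependent_iff.1 hsli (fun i ↦ ((q i : ℚ) : ℂ)) (by rw [← hc]; exact hc0)
    funext i
    exact_mod_cast hq0 i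
  have hGinj : Function.Injective G.vecMul := by
    intro q q' hqq'
    have hqq : Matrix.vecMul q G = Matrix.vecMul q' G := hqq'
    rw [← sub_eq_zero]
    refine hker _ ?_
    rw [Matrix.sub_vecMul, hqq, sub_self]
  have hdet : IsUnit G.det := (Matrix.isUnit_iff_isUnit_det _).1 (Matrix.vecMul_injective_iff_isUnit.1 hGinj)
  -- complex forms of `G * G⁻¹ = 1` and `G⁻¹ * G = 1`
  have hmulinv : ∀ i k, ∑ j, ((G i j : ℚ) : ℂ) * ((G⁻¹ j k : ℚ) : ℂ) = if i = k then 1 else 0 := by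
    intro i k
    have h := congrFun (congrFun (Matrix.mul_nonsing_inv G hdet) i) k
    rw [Matrix.mul_apply, Matrix.one_apply] at h
    have h' := congrArg (fun q : ℚ ↦ (q : ℂ)) h
    simpa [Rat.cast_sum, Rat.cast_mul, apply_ite (fun q : ℚ ↦ (q : ℂ))] using h'
  have hinvmul : ∀ j i, ∑ k, ((G⁻¹ j k : ℚ) : ℂ) * ((G k i : ℚ) : ℂ) = if j = i then 1 else 0 := by
    intro j i
    have h := congrFun (congrFun (Matrix.nonsing_inv_mul G hdet) j) i
    rw [Matrix.mul_apply, Matrix.one_apply] at h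
    have h' := congrArg (fun q : ℚ ↦ (q : ℂ)) h
    simpa [Rat.cast_sum, Rat.cast_mul, apply_ite (fun q : ℚ ↦ (q : ℂ))] using h'
  refine ⟨m, s, G⁻¹, hsQ, hsT, fun c hcQ hcT ↦ hmemS c ⟨hcQ, hcT⟩, ?_, ?_⟩
  · -- `P₀ sᵢ = sᵢ`
    intro i
    simp_rw [← hG]
    calc ∑ k, ∑ j, (((G⁻¹ j k : ℚ) : ℂ) * ((G i j : ℚ) : ℂ)) • s k
        = ∑ k, (if i = k then (1 : ℂ) else 0) • s k := by
          refine Finset.sum_congr rfl fun k _ ↦ ?_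
          rw [← Finset.sum_smul, ← hmulinv i k]
          refine congrArg (· • s k) (Finset.sum_congr rfl fun j _ ↦ mul_comm _ _)
      _ = s i := by simp [ite_smul, Finset.sum_ite_eq]
  · -- `∫ (P₀ x) ∪ sᵢ = ∫ x ∪ sᵢ`
    intro x i
    rw [map_sum, LinearMap.sum_apply, map_sum]
    simp_rw [map_sum, LinearMap.sum_apply, map_sum, map_smul, LinearMap.smul_apply, map_smul, smul_eq_mul,
      ← hG]
    -- `Σ_k Σ_j N_{jk} (∫ x ∪ sⱼ) G_{ki} = Σ_j (∫ x ∪ sⱼ) (Σ_k N_{jk} G_{ki}) = ∫ x ∪ sᵢ`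
    rw [Finset.sum_comm]
    calc ∑ j, ∑ k, ((G⁻¹ j k : ℚ) : ℂ) * traceC hX (cupProduct h4 x (s j)) * ((G k i : ℚ) : ℂ)
        = ∑ j, traceC hX (cupProduct h4 x (s j)) * (if j = i then (1 : ℂ) else 0) := by
          refine Finset.sum_congr rfl fun j _ ↦ ?_
          rw [← hinvmul j i, Finset.mul_sum]
          refine Finset.sum_congr rfl fun k _ ↦ by ring
      _ = traceC hX (cupProduct h4 x (s i)) := by simp [Finset.sum_ite_eq']

/-- **Uniqueness of the orthogonal Hodge projector**: with `s`, `N` as in `exists_gramProjector`, every `ℂ`-linear `P`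
on `H^{2n}(X(ℂ); ℂ)` that is the identity on the rational `(n,n)`-classes and zero on their cup-orthogonal is the Gram
projector `P x = Σ_{k,j} N_{jk} (∫_X x ∪ sⱼ) s_k` (`x = P₀ x + (x - P₀ x)` with `P₀ x ∈ V` and `x - P₀ x` cup-orthogonal
to every rational `(n,n)`-class). [cite: VoisinHodgeI2002, §7.1.2] [cite: BrosnanFangNiePearlstein2009, §6 (6.1)] -/
theorem gramProjector_unique (hX : IsSmoothProjective (2 * n) X) {m : ℕ} {s : Fin m → complexBetti X (2 * n)}
    {N : Matrix (Fin m) (Fin m) ℚ} (hsQ : ∀ i, IsRationalClass (s i))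
    (hsT : ∀ i, IsOfHodgeType (2 * n) X (2 * n) n n (s i))
    (hspan : ∀ c : complexBetti X (2 * n), IsRationalClass c → IsOfHodgeType (2 * n) X (2 * n) n n c →
      c ∈ Submodule.span ℂ (Set.range s))
    (horth : ∀ (x : complexBetti X (2 * n)) (i : Fin m),
      traceC hX (cupProduct (two_mul (2 * n)).symm
          (∑ k, ∑ j, (((N j k : ℚ) : ℂ) * traceC hX (cupProduct (two_mul (2 * n)).symm x (s j))) • s k)
          (s i)) =
        traceC hX (cupProduct (two_mul (2 * n)).symm x (s i)))
    (P : complexBetti X (2 * n) →ₗ[ℂ] complexBetti X (2 * n))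
    (hP₁ : ∀ c : complexBetti X (2 * n), IsRationalClass c → IsOfHodgeType (2 * n) X (2 * n) n n c → P c = c)
    (hP₂ : ∀ b : complexBetti X (2 * n),
      (∀ a : complexBetti X (2 * n), IsRationalClass a → IsOfHodgeType (2 * n) X (2 * n) n n a →
        cupProduct (rfl : 2 * n + 2 * n = 2 * n + 2 * n) a b = 0) → P b = 0)
    (x : complexBetti X (2 * n)) :
    P x = ∑ k, ∑ j, (((N j k : ℚ) : ℂ) * traceC hX (cupProduct (two_mul (2 * n)).symm x (s j))) • s k := by
  have h4 : 2 * n + 2 * n = 2 * (2 * n) := (two_mul (2 * n)).symm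
  set y := ∑ k, ∑ j, (((N j k : ℚ) : ℂ) * traceC hX (cupProduct h4 x (s j))) • s k with hy
  -- `P y = y`
  have hPy : P y = y := by
    rw [hy, map_sum]
    refine Finset.sum_congr rfl fun k _ ↦ ?_
    rw [map_sum]
    refine Finset.sum_congr rfl fun j _ ↦ ?_
    rw [map_smul, hP₁ _ (hsQ k) (hsT k)]
  -- `x - y` is cup-orthogonal to every rational `(n,n)`-class
  have horth' : ∀ a : complexBetti X (2 * n), IsRationalClass a → IsOfHodgeType (2 * n) X (2 * n) n n a →
      cupProduct (rfl : 2 * n + 2 * n = 2 * n + 2 * n) a (x - y) = 0 := by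
    intro a haQ haT
    have hxa : ∀ i, cupProduct h4 (x - y) (s i) = 0 := fun i ↦ by
      apply eq_zero_of_traceC_eq_zero hX
      rw [map_sub, LinearMap.sub_apply, map_sub, hy, horth x i, sub_self]
    have hgen : cupProduct h4 (x - y) a = 0 := by
      refine Submodule.span_induction (p := fun a _ ↦ cupProduct h4 (x - y) a = 0) ?_ ?_ ?_ ?_
        (hspan a haQ haT)
      · rintro _ ⟨i, rfl⟩
        exact hxa i
      · exact map_zero _
      · intro u v _ _ hu hv
        rw [map_add, hu, hv, add_zero]
      · intro t u _ hu
        rw [map_smul, hu, smul_zero]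
    rw [cupProduct_eq_zero_iff_of_degree_eq rfl h4, cupProduct_gradedComm_holds ℂ (ComplexPoints X) h4 h4,
      hgen, smul_zero]
  calc P x = P y + P (x - y) := by rw [← map_add, add_sub_cancel]
    _ = y := by rw [hPy, hP₂ _ horth', add_zero]

/-! ## The Gram–Künneth class -/

/-- **Stub `stub_gramKunnethClass` of crux `HodgeProjectorAlgebraic` (registered signature, verbatim):** the Gram–Künneth
class `π₀ = Σ_{k,j} N_{jk} pr₁^* s_k ∪ pr₂^* sⱼ` of a basis `(s_k)` of rational `(n,n)`-classes (`N` the inverse Gram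
matrix) is rational, of type `(2n,2n)`, lies in the span of the exterior products of rational `(n,n)`-classes, and acts by
`t • P` with `t = λ ε₀ ≠ 0` (projection formula `corrAction_sum_cross_apply`; uniqueness `gramProjector_unique`).
[cite: VoisinHodgeI2002, §11.3.3 Thm. 11.38 and Lemma 11.41 with (11.11)] [cite: HatcherAT2002, §3.3 Prop. 3.38] -/
theorem stub_gramKunnethClass :
    ∀ (n : ℕ) (X : SchemeOver ℂ) (hX : IsSmoothProjective (2 * n) X), 1 ≤ n →
      ∀ P : complexBetti X (2 * n) →ₗ[ℂ] complexBetti X (2 * n),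
        (∀ c : complexBetti X (2 * n), IsRationalClass c → IsOfHodgeType (2 * n) X (2 * n) n n c →
          P c = c) →
        (∀ b : complexBetti X (2 * n),
          (∀ a : complexBetti X (2 * n), IsRationalClass a → IsOfHodgeType (2 * n) X (2 * n) n n a →
            cupProduct (rfl : 2 * n + 2 * n = 2 * n + 2 * n) a b = 0) →
          P b = 0) →
        ∃ π₀ : complexBetti (X ⊗ X) (2 * (2 * n)),
          π₀ ∈ Submodule.span ℂ {v : complexBetti (X ⊗ X) (2 * (2 * n)) |
            ∃ a b : complexBetti X (2 * n), IsRationalClass a ∧ IsOfHodgeType (2 * n) X (2 * n) n n a ∧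
              IsRationalClass b ∧ IsOfHodgeType (2 * n) X (2 * n) n n b ∧
              v = cupProduct (two_mul (2 * n)).symm (complexBetti.map (fst X X) (2 * n) a)
                (complexBetti.map (snd X X) (2 * n) b)} ∧
          IsRationalClass π₀ ∧
          IsOfHodgeType (2 * n + 2 * n) (X ⊗ X) (2 * (2 * n)) (2 * n) (2 * n) π₀ ∧
          ∃ t : ℂ, t ≠ 0 ∧
            corrAction complexOrientationFamily hX hX
              (rfl : 2 * n + 2 * (2 * n) = 2 * n + 2 * (2 * n)) π₀ = t • P := by
  intro n X hX _hn P hP₁ hP₂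
  classical
  have h4 : 2 * n + 2 * n = 2 * (2 * n) := (two_mul (2 * n)).symm
  have hXX := IsSmoothProjective.tensor_holds hX hX
  obtain ⟨AXX⟩ := nonempty_hodgeModel_holds (n := 2 * n + 2 * n) (X := X ⊗ X) hXX
  obtain ⟨m, s, N, hsQ, hsT, hspan, -, horth⟩ := exists_gramProjector hX
  have hPx := gramProjector_unique hX hsQ hsT hspan horth P hP₁ hP₂
  -- the Gram–Künneth class
  let xd : Fin m → complexBetti X (2 * n) := fun k ↦ ∑ j, ((N j k : ℚ) : ℂ) • s j
  set π₀ : complexBetti (X ⊗ X) (2 * (2 * n)) :=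
    ∑ k, cupProduct h4 (complexBetti.map (fst X X) (2 * n) ((LinearMap.id : complexBetti X (2 * n) →ₗ[ℂ] complexBetti X (2 * n)) (s k)))
      (complexBetti.map (snd X X) (2 * n) (xd k)) with hπ₀
  have hπ₀' : π₀ = ∑ k, ∑ j, ((N j k : ℚ) : ℂ) •
      cupProduct h4 (complexBetti.map (fst X X) (2 * n) (s k)) (complexBetti.map (snd X X) (2 * n) (s j)) := by
    rw [hπ₀]
    refine Finset.sum_congr rfl fun k _ ↦ ?_
    simp only [xd, LinearMap.id_apply, map_sum, map_smul]
  refine ⟨π₀, ?_, ?_, ?_, ?_⟩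
  · -- in the span of the exterior products of rational `(n,n)`-classes
    rw [hπ₀']
    refine Submodule.sum_mem _ fun k _ ↦ Submodule.sum_mem _ fun j _ ↦ Submodule.smul_mem _ _
      (Submodule.subset_span ⟨s k, s j, hsQ k, hsT k, hsQ j, hsT j, rfl⟩)
  · -- rational
    rw [hπ₀']
    refine isRationalClass_sum _ _ fun k _ ↦ isRationalClass_sum _ _ fun j _ ↦ ?_
    exact (((hsQ k).pullback _).cup h4 ((hsQ j).pullback _)).smul _
  · -- of Hodge type `(2n, 2n)`
    rw [hπ₀']
    refine IsOfHodgeType.sum hXX AXX _ _ fun k _ ↦ IsOfHodgeType.sum hXX AXX _ _ fun j _ ↦ ?_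
    have h := isOfHodgeType_cupProduct_map_map_of_multiplicative_deRham
      (fun E _ _ _ ↦ Literature.NumberTheory.Transcendental.exists_deRhamIsoFamily_holds E)
      hXX hX hX (fst X X) (snd X X) h4 (hsT k) (hsT j)
    rw [← two_mul n] at h
    exact h.smul _
  · -- the action: projection formula
    obtain ⟨ω₁, lam, hlam0, hω₁, hlam⟩ :=
      exists_complexGysin_fst_map_snd_eq_smul_one complexOrientationFamily hX hX
    refine ⟨lam * (pointSign : ℂ), mul_ne_zero hlam0 (by exact_mod_cast pointSign_ne_zero), ?_⟩
    refine LinearMap.ext fun u ↦ ?_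
    rw [hπ₀, corrAction_sum_cross_apply complexOrientationFamily hX hX rfl h4 h4 LinearMap.id s xd hω₁ hlam u,
      LinearMap.smul_apply, hPx u, Finset.smul_sum]
    rw [show ((-1 : ℂ) ^ (2 * n * (2 * n)) * lam) = lam by
      rw [Even.neg_one_pow ⟨n * (2 * n), by ring⟩, one_mul]]
    rw [Finset.smul_sum]
    refine Finset.sum_congr rfl fun k _ ↦ ?_
    rw [LinearMap.id_apply, smul_smul, ← Finset.sum_smul, smul_smul]
    congr 1
    have hp : (pointSign : ℂ) ≠ 0 := by exact_mod_cast pointSign_ne_zero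
    simp only [xd, map_sum, map_smul, smul_eq_mul, cupPairing_apply, traceC_apply, Finset.mul_sum]
    refine Finset.sum_congr rfl fun j _ ↦ ?_
    field_simp

end Summit.HodgeConjecture.HodgeConjecture.Theorems.HodgeProjectorAlgebraic

end
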